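import Mathlib

/-!
# Column echelon with provenance over `𝔽₂` (stub `stub_echelonCombos`)

The stub `stub_echelonCombos` of the crux `MobiusLadder.QuadraticDigitPhases`
(stmt-QuantumAdvantage-1391), line `Sketch`.

Given an `n × n` matrix `M` over `ZMod 2` whose rows indexed outside a set `B ⊆ ℕ` vanish, and
`r ≤ M.rank`, we produce `r` subsets `u i ⊆ B` and pivot columns `c i < n`, strictly decreasing
in `i`, such that the sum of the rows of `M` indexed by `u i` has entry `1` in column `c i` and
entry `0` in every later column.

The proof is algorithm-free.  Let `V` be the row space of `M` and let `T` be the set of columns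
`j` occurring as the rightmost non-zero coordinate ("top") of some vector of `V`.  The coordinate
restriction `v ↦ (v j)_{j ∈ T}` is injective on `V` (a non-zero vector of `V` is non-zero at its
own top, which lies in `T`), so `M.rank = finrank V ≤ #T`.  Over `ZMod 2` every vector of `V` is
a subset sum of rows, and rows outside `B` may be discarded, so each top in `T` is realised by a
subset `u ⊆ B`; enumerating `r` elements of `T` in decreasing order gives the pivots.
Elementary linear algebra (folklore); Mathlib only.
-/

set_option linter.dupNamespace false -- D-0017: single-problem summit ⇒ `QuantumAdvantage.QuantumAdvantage` by design

namespace Summit.QuantumAdvantage.QuantumAdvantage.Theorems.MobiusLadderQuadraticDigitPhasesStubEchelonCombos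

/-- If every "top" (rightmost non-zero coordinate) of a non-zero vector of a subspace
`V ≤ (Fin n → K)` lies in `T`, then `finrank V ≤ #T`: the restriction to the coordinates in `T`
is injective on `V`. [folklore] -/
theorem finrank_le_card_tops {K : Type*} [Field K] {n : ℕ}
    (V : Submodule K (Fin n → K)) (T : Finset (Fin n))
    (hT : ∀ v ∈ V, ∀ j : Fin n, v j ≠ 0 → (∀ k : Fin n, j < k → v k = 0) → j ∈ T) :
    Module.finrank K V ≤ T.card := by
  classical
  let ψ : V →ₗ[K] (T → K) :=
    LinearMap.pi fun j => (LinearMap.proj (j : Fin n)) ∘ₗ V.subtype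
  have hψ : Function.Injective ψ := by
    refine (injective_iff_map_eq_zero ψ).2 fun v hv => ?_
    by_contra hne
    have hne' : (v : Fin n → K) ≠ 0 := fun h => hne (by simpa using h)
    obtain ⟨j₀, hj₀⟩ := Function.ne_iff.mp hne'
    obtain ⟨t, ht, hmax⟩ :=
      (Finset.univ.filter fun j : Fin n => (v : Fin n → K) j ≠ 0).exists_max_image id
        ⟨j₀, by simpa using hj₀⟩
    simp only [Finset.mem_filter, Finset.mem_univ, true_and, id] at ht hmax
    have htT : t ∈ T := hT v v.2 t ht fun k hk => by
      by_contra hk0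
      exact absurd (hmax k hk0) (not_le.mpr hk)
    have h0 : (v : Fin n → K) t = 0 := by
      have := congrFun hv ⟨t, htT⟩
      simpa [ψ] using this
    exact ht h0
  simpa [Module.finrank_fintype_fun_eq_card, Fintype.card_coe] using
    LinearMap.finrank_le_finrank_of_injective hψ

/-- Over `ZMod 2`, a vector of the row span of `M` is the sum of the rows indexed by a subset of
`B` (the rows indexed outside `B` vanish), written coordinatewise in `dite` form. [folklore] -/
theorem exists_subset_sum_eq {n : ℕ} (B : Finset ℕ) (M : Matrix (Fin n) (Fin n) (ZMod 2))
    (hB : ∀ i : Fin n, (i : ℕ) ∉ B → M i = 0) (v : Fin n → ZMod 2)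
    (hv : v ∈ Submodule.span (ZMod 2) (Set.range M)) :
    ∃ u : Finset ℕ, u ⊆ B ∧ ∀ (j : ℕ) (hj : j < n),
      (∑ b ∈ u, if h : b < n ∧ j < n then M ⟨b, h.1⟩ ⟨j, h.2⟩ else 0) = v ⟨j, hj⟩ := by
  classical
  obtain ⟨coef, hcoef⟩ := (Submodule.mem_span_range_iff_exists_fun (ZMod 2)).1 hv
  subst hcoef
  refine ⟨(Finset.univ.filter fun i : Fin n => coef i = 1 ∧ (i : ℕ) ∈ B).image Fin.val, ?_, ?_⟩
  · intro b hb
    simp only [Finset.mem_image, Finset.mem_filter, Finset.mem_univ, true_and] at hb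
    obtain ⟨i, ⟨-, hi⟩, rfl⟩ := hb
    exact hi
  · intro j hj
    rw [Finset.sum_image fun x _ y _ h => Fin.ext h, Finset.sum_apply, Finset.sum_filter]
    refine Finset.sum_congr rfl fun i _ => ?_
    rw [dif_pos (And.intro i.is_lt hj)]
    rcases (by decide : ∀ x : ZMod 2, x = 0 ∨ x = 1) (coef i) with h0 | h1
    · simp [h0]
    · by_cases hiB : (i : ℕ) ∈ B
      · simp [h1, hiB]
      · simp [h1, hiB, hB i hiB]

/-- A finite set of naturals with at least `r` elements has `r` of its elements enumerated in
strictly decreasing order. -/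
theorem exists_strictAnti_enum (P : Finset ℕ) (r : ℕ) (hr : r ≤ P.card) :
    ∃ c : ℕ → ℕ, (∀ i, i < r → c i ∈ P) ∧ (∀ i, i + 1 < r → c (i + 1) < c i) := by
  rcases Nat.eq_zero_or_pos P.card with h0 | hpos
  · exact ⟨fun _ => 0, fun i hi => by omega, fun i hi => by omega⟩
  · refine ⟨fun i => P.orderEmbOfFin rfl ⟨P.card - 1 - i, by omega⟩,
      fun i _ => Finset.orderEmbOfFin_mem _ _ _, fun i hi => ?_⟩
    exact (P.orderEmbOfFin rfl).strictMono (Fin.mk_lt_mk.mpr (by omega))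

/-- **Column echelon with provenance over `𝔽₂`.**  If the rows of the `n × n` matrix `M` over
`ZMod 2` indexed outside `B` vanish and `r ≤ M.rank`, then there are `r` subsets `u i ⊆ B` and
pivot columns `c i < n`, strictly decreasing in `i < r`, such that the sum of the rows of `M`
indexed by `u i` is `1` in column `c i` and `0` in every column `j > c i`. [folklore] -/
theorem stub_echelonCombos :
    ∀ (n r : ℕ) (B : Finset ℕ) (M : Matrix (Fin n) (Fin n) (ZMod 2)),
      (∀ i : Fin n, (i : ℕ) ∉ B → M i = 0) → r ≤ M.rank →
      ∃ (u : ℕ → Finset ℕ) (c : ℕ → ℕ),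
        (∀ i, i < r → u i ⊆ B ∧ c i < n ∧
          (∑ b ∈ u i, (if h : b < n ∧ c i < n then M ⟨b, h.1⟩ ⟨c i, h.2⟩ else 0)) = 1 ∧
          (∀ j, c i < j → j < n → (∑ b ∈ u i, (if h : b < n ∧ j < n then M ⟨b, h.1⟩ ⟨j, h.2⟩ else 0)) = 0)) ∧
        (∀ i, i + 1 < r → c (i + 1) < c i) := by
  intro n r B M hB hr
  classical
  -- the set `T` of "top" columns of the row space
  obtain ⟨T, hTdef⟩ : ∃ T : Finset (Fin n), T = Finset.univ.filter fun j : Fin n =>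
      ∃ v ∈ Submodule.span (ZMod 2) (Set.range M), v j ≠ 0 ∧ ∀ k : Fin n, j < k → v k = 0 :=
    ⟨_, rfl⟩
  have hcard : r ≤ T.card := by
    refine hr.trans ?_
    rw [Matrix.rank_eq_finrank_span_row M]
    exact finrank_le_card_tops _ T fun v hv j hj hk => by
      rw [hTdef, Finset.mem_filter]
      exact ⟨Finset.mem_univ _, v, hv, hj, hk⟩
  have hPcard : r ≤ (T.image Fin.val).card := by
    rwa [Finset.card_image_of_injective _ Fin.val_injective]
  -- every top is realised by a subset of `B`
  have hrep : ∀ p ∈ T.image Fin.val, ∃ u : Finset ℕ, u ⊆ B ∧ p < n ∧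
      (∑ b ∈ u, (if h : b < n ∧ p < n then M ⟨b, h.1⟩ ⟨p, h.2⟩ else 0)) = 1 ∧
      ∀ j : ℕ, p < j → j < n →
        (∑ b ∈ u, (if h : b < n ∧ j < n then M ⟨b, h.1⟩ ⟨j, h.2⟩ else 0)) = 0 := by
    intro p hp
    rw [Finset.mem_image] at hp
    obtain ⟨j, hjT, hjp⟩ := hp
    have hpn : p < n := hjp ▸ j.is_lt
    obtain rfl : j = ⟨p, hpn⟩ := Fin.ext hjp
    rw [hTdef, Finset.mem_filter] at hjT
    obtain ⟨-, v, hvV, hvj, hvk⟩ := hjT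
    obtain ⟨u, huB, hu⟩ := exists_subset_sum_eq B M hB v hvV
    refine ⟨u, huB, hpn, ?_, fun j' hjj' hj'n => ?_⟩
    · rw [hu p hpn]
      exact ((by decide : ∀ x : ZMod 2, x = 0 ∨ x = 1) _).resolve_left hvj
    · rw [hu j' hj'n]
      exact hvk ⟨j', hj'n⟩ hjj'
  choose! f hf using hrep
  obtain ⟨c, hcP, hcdec⟩ := exists_strictAnti_enum _ r hPcard
  exact ⟨fun i => f (c i), c, fun i hi => hf (c i) (hcP i hi), hcdec⟩

end Summit.QuantumAdvantage.QuantumAdvantage.Theorems.MobiusLadderQuadraticDigitPhasesStubEchelonCombos
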